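import Summits.HubbardSuperconductivity.HubbardSuperconductivity.Theorems.AnisotropyChordTransferFibre3Level2Toolkit
import Summits.HubbardSuperconductivity.HubbardSuperconductivity.Theorems.AnisotropyChordTransferFibre3TtailBounds

/-!
# Route `AnisotropyChord` / H0 rotor rung: PartN35 (Level-2 toolkit) — `GfunZero`, `ProfileFromGreen`, `DeltaExplicit` PROVED

PartN35 = `…Fibre3Level2Toolkit` (theory seat `hubbard-h0-rotor-theory-1`, memo 21 §309–§312; port by `hubbard-h0-rotor-p2`).
This file proves the three Fourier-inversion / Green-zero corollaries of that file:

* `dft_inversion` — lattice Fourier inversion on the torus, `Σ_k ĝ(k) e^{ik·r} = V·g(r)`;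
* **`gfunZero_holds : GfunZero L`** — `G_λ(0) = Gzero λ` (the `k = 0` term of `gres` vanishes, `e^{i k·0} = 1`);
* **`profileFromGreen_holds (3 ≤ L) (Δ) : ProfileFromGreen L Δ`** — `f(r) = 1 + Δ f(x̂)/V − c_s G_λ(r)` off the origin:
  Fourier inversion of the small part `s = 1 − f − Δ f(x̂) δ₀`, whose transform is `ŝ(0) = −Δ f(x̂)`, `ŝ(k) = c_s/(2ε(k) − λ)`
  (`dft_sfun'`, `…Fibre3TtailBounds`);
* **`deltaExplicit_holds (3 ≤ L) (Δ) : DeltaExplicit L Δ`** — the gap equation solved for `Δ`, pure algebra from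
  `greenZeroIdentity_holds` (`G(0) = 1/(Vλ) − Δ/(4(1−Δ) + Δλ)`, with `4(1−Δ) + Δλ > 0` from the sum rule and `λ < 2ε₁ ≤ 4`).

`3 ≤ L` is inherited from `TwoMagnonFourier` / `GreenZeroIdentity`.  Nothing here proves superconductivity in the Hubbard model;
these are helper lemmas of ONE conditional reduction (rung stmt-HubbardSuperconductivity-19089).
Prover seat `hubbard-h0-rotor-p3` g0; `--supports stmt-HubbardSuperconductivity-19089`.
-/

set_option linter.dupNamespace false
set_option autoImplicit false

noncomputable section

open scoped BigOperators
open Complex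

namespace Summit.HubbardSuperconductivity.HubbardSuperconductivity.Theorems.AnisotropyChord.Transfer.Fibre3

variable (L : ℕ) [NeZero L]

/-! ## Fourier inversion on the torus -/

/-- **Fourier inversion:** `Σ_k ĝ(k) e^{ik·r} = V·g(r)`. [folklore] -/
theorem dft_inversion (g : Tor L → ℝ) (r : Tor L) :
    ∑ k : Tor L, dft L g k * phase L k r = ((L : ℂ) ^ 2) * (g r : ℂ) := by
  classical
  unfold dft
  simp_rw [Finset.sum_mul]
  rw [Finset.sum_comm]
  have key : ∀ r' : Tor L, ∑ k : Tor L, (starRingEnd ℂ) (phase L k r') * (g r' : ℂ) * phase L k r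
      = if r = r' then ((L : ℂ) ^ 2) * (g r' : ℂ) else 0 := by
    intro r'
    have e : ∀ k : Tor L, (starRingEnd ℂ) (phase L k r') * (g r' : ℂ) * phase L k r = (g r' : ℂ) * phase L k (r - r') := by
      intro k
      rw [conj_phase, show r - r' = -r' + r by abel, phase_add]; ring
    rw [Finset.sum_congr rfl fun k _ => e k, ← Finset.mul_sum, sum_phase_left]
    by_cases h : r = r'
    · rw [if_pos (sub_eq_zero.mpr h), if_pos h]; ring
    · rw [if_neg (fun h' => h (sub_eq_zero.mp h')), if_neg h]; ring
  rw [Finset.sum_congr rfl fun r' _ => key r', Finset.sum_ite_eq]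
  simp

/-! ## `GfunZero` -/

/-- ★ **`GfunZero L` holds:** `G_λ(0) = Gzero λ`. [folklore] -/
theorem gfunZero_holds : GfunZero L := by
  classical
  intro lam2
  unfold Gres Gzero
  congr 1
  rw [← Finset.add_sum_erase _ _ (Finset.mem_univ (0 : Tor L))]
  have h0 : gres L lam2 0 * (phase L 0 0).re = 0 := by unfold gres; simp
  rw [h0, zero_add]
  refine Finset.sum_congr rfl fun k hk => ?_
  have hk0 : k ≠ 0 := Finset.ne_of_mem_erase hk
  unfold gres
  rw [if_neg hk0, phase_zero, Complex.one_re, mul_one]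

/-! ## `ProfileFromGreen` -/

/-- the Green's function sum with the constant `c_s` pulled in, and the `k = 0` term made explicit. [folklore] -/
theorem sum_shat_phase_re {Δ lam2 : ℝ} (f : Tor L → ℝ) (r : Tor L) :
    ∑ k : Tor L, (if k = 0 then -(Δ * f (K1 L)) else cS L Δ lam2 f / (2 * epsT L k - lam2)) * (phase L k r).re
      = -(Δ * f (K1 L)) + cS L Δ lam2 f * ((L : ℝ) ^ 2 * Gres L lam2 r) := by
  classical
  have hV : ((L : ℝ) ^ 2) ≠ 0 := by
    have : (L : ℝ) ≠ 0 := by exact_mod_cast (NeZero.ne L)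
    positivity
  unfold Gres
  rw [mul_div_cancel₀ _ hV, Finset.mul_sum,
    ← Finset.add_sum_erase _ _ (Finset.mem_univ (0 : Tor L)),
    ← Finset.add_sum_erase _ (fun k => cS L Δ lam2 f * (gres L lam2 k * (phase L k r).re)) (Finset.mem_univ (0 : Tor L))]
  have h0 : cS L Δ lam2 f * (gres L lam2 0 * (phase L 0 r).re) = 0 := by unfold gres; simp
  rw [h0, zero_add, if_pos rfl, phase_zero_left, Complex.one_re, mul_one]
  congr 1
  refine Finset.sum_congr rfl fun k hk => ?_
  have hk0 : k ≠ 0 := Finset.ne_of_mem_erase hk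
  unfold gres
  rw [if_neg hk0, if_neg hk0]
  ring

/-- ★ **`ProfileFromGreen L Δ` holds for `L ≥ 3`:** `f(r) = 1 + Δ f(x̂)/V − c_s G_λ(r)` (`r ≠ 0`). [folklore] -/
theorem profileFromGreen_holds (hL : 3 ≤ L) (Δ : ℝ) : ProfileFromGreen L Δ := by
  classical
  intro lam2 f htm _hl0 hl2 r hr
  have hV : ((L : ℝ) ^ 2) ≠ 0 := by
    have : (L : ℝ) ≠ 0 := by exact_mod_cast (NeZero.ne L)
    positivity
  -- Fourier inversion for `s`, real parts
  have hinv := dft_inversion L (sfun' L Δ f) r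
  simp only [dft_sfun' L hL htm hl2] at hinv
  have hR : ((L : ℂ) ^ 2) * ((sfun' L Δ f r : ℝ) : ℂ) = ((((L : ℝ) ^ 2 * sfun' L Δ f r : ℝ)) : ℂ) := by
    push_cast; ring
  rw [hR] at hinv
  have hre := congrArg Complex.re hinv
  rw [Complex.ofReal_re, Complex.re_sum] at hre
  simp only [Complex.re_ofReal_mul] at hre
  rw [sum_shat_phase_re] at hre
  -- `s(r) = 1 − f(r)` off the origin
  have hsr : sfun' L Δ f r = 1 - f r := by simp only [sfun', if_neg hr]
  rw [hsr] at hre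
  -- solve for `f r`
  have key : f r * (L : ℝ) ^ 2
      = (L : ℝ) ^ 2 + Δ * f (K1 L) - cS L Δ lam2 f * Gres L lam2 r * (L : ℝ) ^ 2 := by
    linear_combination hre
  field_simp
  linear_combination key

/-! ## `DeltaExplicit` -/

/-- ★ **`DeltaExplicit L Δ` holds for `L ≥ 3`.** [folklore] -/
theorem deltaExplicit_holds (hL : 3 ≤ L) (Δ : ℝ) : DeltaExplicit L Δ := by
  intro lam2 f htm hl0 hl2
  have hG : Gzero L lam2 = 1 / ((L : ℝ) ^ 2 * lam2) - Δ / (4 * (1 - Δ) + Δ * lam2) :=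
    greenZeroIdentity_holds L hL Δ lam2 f htm hl0 hl2
  have hVpos : 0 < (L : ℝ) ^ 2 := by
    have : (0 : ℝ) < L := by exact_mod_cast (show 0 < L by omega)
    positivity
  have hrule := lam2_sum_rule L hL htm
  have hpos : 0 < f (K1 L) := htm.2.2.1
  have h1Δ : 0 < 1 - Δ := by
    have h4 : 0 < 4 * (1 - Δ) * f (K1 L) := by rw [← hrule]; exact mul_pos hl0 hVpos
    nlinarith
  have heps : eps1 L ≤ 2 := by
    unfold eps1
    have := Real.neg_one_le_cos (2 * Real.pi / L)
    linarith
  have hl4 : lam2 < 4 := by linarith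
  have hA : 0 < 4 * (1 - Δ) + Δ * lam2 := by
    by_cases hΔ : 0 ≤ Δ
    · nlinarith [mul_nonneg hΔ hl0.le]
    · have hΔ' : Δ < 0 := not_le.mp hΔ
      nlinarith [mul_pos_of_neg_of_neg hΔ' (by linarith : lam2 - 4 < 0)]
  have hA0 : 4 * (1 - Δ) + Δ * lam2 ≠ 0 := hA.ne'
  have hV0 : (L : ℝ) ^ 2 ≠ 0 := hVpos.ne'
  have hl0' : lam2 ≠ 0 := hl0.ne'
  rw [hG]
  field_simp
  ring

end Summit.HubbardSuperconductivity.HubbardSuperconductivity.Theorems.AnisotropyChord.Transfer.Fibre3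

end
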